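/-
Copyright: lit-balaban cell, Phase-2 proof seat p11 (gen 4).  Skeleton of a published paper; no claims beyond what the kernel checks.
-/
import Literature.MathematicalPhysics.QuantumFieldTheory.BalabanImbrieJaffe1984to88.BIJ85PropagatorRG242

/-!
# `BalabanImbrieJaffe1984to88.BIJ85PropagatorRG243` — T. Bałaban, J. Imbrie, A. Jaffe, *Renormalization of the Higgs model: minimizers,
propagators and the stability of mean field theory*, Commun. Math. Phys. **97** (1985) 299–329 [BalabanImbrieJaffe1985], Sect. 4.6 p. 313
(*"The other propagators such as C^{(k)}(u_k) are defined as in [3]"*) with [3] = T. Bałaban, *(Higgs)₂,₃ quantum fields in a finite volume I*,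
Commun. Math. Phys. **85** (1982) 603–626 [Balaban1982Higgs1] p. 612, **(2.43) — the solved renormalization-group equation for the propagators,
PROVED FOR THE C1 PROPAGATORS `G_k(u)` AT EVERY `U(1)` BACKGROUND on the torus model of record** (the companion `BIJ85PropagatorRG242` proves
(2.41)/(2.42); this file iterates (2.42)).

statement-level skeleton of published theorems with citation tags; proofs where landed; nothing here is a claim about the Yang–Mills mass gap

PDF held: `paper:balaban1985-cmp97-bij-higgs-minimizers` (journal page = PDF page + 298), p. 313 [PDF 15]; [3] = `paper:balaban1982-cmp85-higgs23-i`
(journal page = PDF page + 602), p. 612 [PDF 10] (`lit read`, this session).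

CITATION HEADER (lean-in-tree rule).  Phase-2 file of the lit-balaban TYPED SKELETON (HOME `run/shared/lean/pub/lit-balaban/`), seat p11 gen 4
(unit `lit-balaban-p11-g4`; owner r15, referee ref-5; own lane = the C1 scalar sector §4.6).  WHAT IS REPRODUCED: row **C1.Eq4.6.2-4.6.4** (last
clause) KNITTED with row **B1.Eq2.43** (owner r14) — kind «model-instance».  PRIOR ART IN THE TREE (cited, not restated): r14's
`Balaban1983to89.B1RG242.Tower.display243` (abstract, under `Tower.Consistent`) and `B1RG242Torus` (the real scalar tower at `U = 1`).

THE PRINTED TEXT, verbatim ([3] p. 612 [PDF 10]): *"The formula (2.42) is used for similar purposes and it has a fundamental meaning for the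
analysis of the perturbation expansions, especially for the proof of its renormalizability. More exactly, an equality obtained by solving (2.42),
i.e. applying (2.42) k times, has such a meaning. Using the identity G^ε_1(Ω, A) = C^{(0),ε}(Ω, A), we get
G^ε_k(Ω, A) = Σ_{j=1}^{k−1} a_j²(L^jε)^{−4}G^ε_j(Ω, A)Q^*_j(A)C^{(j),L^jε}(Ω, A)Q_j(A)G^ε_j(Ω, A) + C^{(0),ε}(Ω, A). (2.43)"*

NORMALIZATION (as in `BIJ85PropagatorRG242`): weights absorbed into the carriers' unweighted products (`a_j²(L^jε)^{−4}` ↦ `a_j²`); each `G_i(u)` is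
taken in ITS unit-lattice frame (printed `a_i`, `c_i = cPhys i`), so the frame changes contribute the powers `(L^d/L²)^{k−i}` (`eq_nextG`:
`G_{i+1} = (L^d/L²)[G_i + a_i²G_iQ_i^*C^{(i)}Q_iG_i]`); C1 is massless, so the base term is `G_1(u) = [D^*_uD_u + aQ(u)^*Q(u)]^{−1}` ((3.26)) in
place of [3]'s `C^{(0),ε} = G^ε_1`.

WHAT IS PROVED (0 `sorry`, standard axioms; theorems only): **`rg243`** — for every `u`, `a > 0`, any families of inverses `G_i(u)` (4.6.2) and
covariances `C^{(i)}(u)` ([3] (2.31)) in the standing range, and every `k ≥ 1` with `j + k ≤ m + K`: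
`G_k = (L^d/L²)^{k−1}·G_1 + Σ_{i∈[1,k)} (L^d/L²)^{k−i}a_i²·G_iQ_i(u)^*C^{(i)}Q_i(u)G_i` (induction on `k` with `BIJ85PropagatorRG242.eq_nextG`);
**`rg243_exists`** — hypothesis-free form (the families exist: gen 3 `exists_GK`, gen 4 `exists_C`).
HONEST SCOPE.  Restricted sets `Ω`, `Λ` of [3] are the whole torus (C1 is periodic); the mass term of [3]'s `Δ^{(0)}` is absent in C1.
-/

open scoped RealInnerProductSpace BigOperators
open Finset

namespace Literature.MathematicalPhysics.QuantumFieldTheory.BalabanImbrieJaffe1984to88.BIJ85PropagatorRG243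

open Literature.MathematicalPhysics.QuantumFieldTheory.Balaban1983to89
open BIJ88Sect3Statements (U1 toC cfg covD)
open BIJ85BlockAveragesTorus BIJ85BlockAveragesTorusK BIJ85ScalarPropagatorTorus BIJ85ScalarPropagatorTorusK
open BIJ85ScalarForm464 BIJ85Eq461Proof BIJ85BlockAveragingIneq BIJ85Ineq732Flat BIJ85FluctuationCovariance
open BIJ85FluctuationCovarianceFlatBounds BIJ85ScalarFormSemigroup BIJ85PropagatorRG242

noncomputable section

variable {P : Params} {j : ℕ}

/-- **(2.43) of [3] FOR THE C1 PROPAGATORS AT EVERY `U(1)` BACKGROUND** — *"an equality obtained by solving (2.42), i.e. applying (2.42)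
k times"*: for ANY family `G_i = G_i(u)` of inverses (4.6.2) at the printed `(c_i, a_i)` (`1 ≤ i`, `j + i ≤ m + K`) and ANY family `C^{(i)}(u)` of the
covariances `(aL^{d−2}Q(u^{(i)})^*Q(u^{(i)}) + Δ_i(u))^{−1}`, for every `k ≥ 1` in the standing range,
`G_k = (L^d/L²)^{k−1}·G_1 + Σ_{i=1}^{k−1} (L^d/L²)^{k−i}a_i²·G_iQ_i^*C^{(i)}Q_iG_i` (each `G_i` in its own unit-lattice frame; the powers of `L^d/L²`
are the frame changes of `eq_nextG`; in C1, massless, the base term is `G_1(u)` itself, [3]'s `G^ε_1 = C^{(0),ε}`). [cite: Balaban1982Higgs1, (2.43) p.612] -/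
theorem rg243 (U : GaugeField P j U1) {a : ℝ} (ha : 0 < a) (G : ℕ → (FineSp P j →ₗ[ℝ] FineSp P j))
    (C : (i : ℕ) → (CoarseSpK P j i →ₗ[ℝ] CoarseSpK P j i))
    (hG : ∀ i, 1 ≤ i → j + i ≤ P.m + P.K →
      ∀ φ, opT (Dlin (cPhys P i) U) (QlinK U i) (BIJ85Sect4Statements.aK a P.L i) (G i φ) = φ)
    (hC : ∀ i, 1 ≤ i → j + i + 1 ≤ P.m + P.K →
      ∀ ψ, covOp (QlinK U i) (BIJ85Sect4Statements.aK a P.L i) (G i) (Qlin (lineIter U i))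
        (a * ((P.L : ℝ) ^ P.d / (P.L : ℝ) ^ 2)) (C i ψ) = ψ) :
    ∀ k, 1 ≤ k → j + k ≤ P.m + P.K →
      G k = ((P.L : ℝ) ^ P.d / (P.L : ℝ) ^ 2) ^ (k - 1) • G 1
        + ∑ i ∈ Finset.Ico 1 k, (((P.L : ℝ) ^ P.d / (P.L : ℝ) ^ 2) ^ (k - i) * BIJ85Sect4Statements.aK a P.L i ^ 2)
            • (G i ∘ₗ (QlinK U i).adjoint ∘ₗ C i ∘ₗ QlinK U i ∘ₗ G i) := by
  intro k hk1 hk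
  induction k with
  | zero => omega
  | succ k ih =>
    rcases Nat.lt_or_ge k 1 with h0 | h1
    · have : k = 0 := by omega
      subst this
      simp
    · have hkk : j + k ≤ P.m + P.K := by omega
      have e := eq_nextG h1 (by omega) U ha (hG k h1 hkk) (hC k h1 (by omega)) (hG (k+1) hk1 hk)
      set r : ℝ := (P.L : ℝ) ^ P.d / (P.L : ℝ) ^ 2 with hr
      rw [e, smul_add, Finset.sum_Ico_succ_top h1, ← add_assoc, show k + 1 - 1 = k - 1 + 1 by omega,
        show k + 1 - k = 1 by omega, pow_one]
      congr 1
      · rw [ih h1 hkk, smul_add, smul_smul, ← pow_succ' r (k - 1), Finset.smul_sum]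
        congr 1
        refine Finset.sum_congr rfl fun i hi => ?_
        rw [Finset.mem_Ico] at hi
        rw [smul_smul, show k + 1 - i = k - i + 1 by omega, pow_succ' r (k - i)]
        congr 1
        ring
      · rw [smul_smul]


/-- **(2.43), hypothesis-free**: for every `u` and `a > 0` there ARE such families (gen 3 `exists_GK`, gen 4 `exists_C`; the members outside the
standing range are irrelevant) and the telescoped formula holds for every `k ≥ 1`, `j + k ≤ m + K`. [cite: Balaban1982Higgs1, (2.43) p.612] -/
theorem rg243_exists (U : GaugeField P j U1) {a : ℝ} (ha : 0 < a) :
    ∃ (G : ℕ → (FineSp P j →ₗ[ℝ] FineSp P j)) (C : (i : ℕ) → (CoarseSpK P j i →ₗ[ℝ] CoarseSpK P j i)),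
      (∀ i, 1 ≤ i → j + i ≤ P.m + P.K →
        ∀ φ, opT (Dlin (cPhys P i) U) (QlinK U i) (BIJ85Sect4Statements.aK a P.L i) (G i φ) = φ) ∧
      (∀ i, 1 ≤ i → j + i + 1 ≤ P.m + P.K →
        ∀ ψ, covOp (QlinK U i) (BIJ85Sect4Statements.aK a P.L i) (G i) (Qlin (lineIter U i))
          (a * ((P.L : ℝ) ^ P.d / (P.L : ℝ) ^ 2)) (C i ψ) = ψ) ∧
      ∀ k, 1 ≤ k → j + k ≤ P.m + P.K →
        G k = ((P.L : ℝ) ^ P.d / (P.L : ℝ) ^ 2) ^ (k - 1) • G 1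
          + ∑ i ∈ Finset.Ico 1 k, (((P.L : ℝ) ^ P.d / (P.L : ℝ) ^ 2) ^ (k - i) * BIJ85Sect4Statements.aK a P.L i ^ 2)
              • (G i ∘ₗ (QlinK U i).adjoint ∘ₗ C i ∘ₗ QlinK U i ∘ₗ G i) := by
  classical
  have hL : (1 : ℝ) < P.L := by linarith [three_le_L P]
  have hr : (0 : ℝ) < (P.L : ℝ) ^ P.d / (P.L : ℝ) ^ 2 := by positivity
  have hα : ∀ i, 1 ≤ i → 0 < BIJ85Sect4Statements.aK a P.L i := fun i hi => (BIJ85CoefficientAk464.aK_pos_le ha hL hi).1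
  -- the inverses G_i(u), chosen where they exist
  have exG : ∀ i, ∃ Gi : FineSp P j →ₗ[ℝ] FineSp P j, 1 ≤ i → j + i ≤ P.m + P.K →
      ∀ φ, opT (Dlin (cPhys P i) U) (QlinK U i) (BIJ85Sect4Statements.aK a P.L i) (Gi φ) = φ := by
    intro i
    by_cases h : 1 ≤ i ∧ j + i ≤ P.m + P.K
    · obtain ⟨Gi, hGi, -⟩ := exists_GK h.2 (cPhys_pos P i).ne' (hα i h.1) U
      exact ⟨Gi, fun _ _ => hGi⟩
    · exact ⟨0, fun h1 h2 => absurd ⟨h1, h2⟩ h⟩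
  choose G hG using exG
  have exC : ∀ i, ∃ Ci : CoarseSpK P j i →ₗ[ℝ] CoarseSpK P j i, 1 ≤ i → j + i + 1 ≤ P.m + P.K →
      ∀ ψ, covOp (QlinK U i) (BIJ85Sect4Statements.aK a P.L i) (G i) (Qlin (lineIter U i))
        (a * ((P.L : ℝ) ^ P.d / (P.L : ℝ) ^ 2)) (Ci ψ) = ψ := by
    intro i
    by_cases h : 1 ≤ i ∧ j + i + 1 ≤ P.m + P.K
    · obtain ⟨Ci, hCi, -⟩ := exists_C h.2 (cPhys_pos P i).ne' (hα i h.1) (mul_pos ha hr) U (hG i h.1 (by omega))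
      exact ⟨Ci, fun _ _ => hCi⟩
    · exact ⟨0, fun h1 h2 => absurd ⟨h1, h2⟩ h⟩
  choose C hC using exC
  exact ⟨G, C, hG, hC, rg243 U ha G C hG hC⟩


end

end Literature.MathematicalPhysics.QuantumFieldTheory.BalabanImbrieJaffe1984to88.BIJ85PropagatorRG243
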